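import Summits.QuantumFields.YangMills.Theorems.ColdStartUniversalityLatticeLangevinHaarLogSobolev
import Summits.QuantumFields.YangMills.Theorems.ColdStartUniversalityLatticeLangevinWilsonEntropyDecayLaw
import Literature.Probability.MarkovChains.HolleyStroockPerturbation
import Literature.MathematicalPhysics.QuantumLattice.TorusWilsonGibbs
import HarnessLib

/-!
# Route `ColdStartUniversality` (fixed-cut-off package, entropy side): the EXPLICIT LOG-SOBOLEV INEQUALITY for the Wilson measure
# `μ_{β'}` of the SU(2) SZZ dynamics at every fixed cut-off (Holley–Stroock from `β' = 0`), and the explicit exponential decay of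
# the relative entropy `KL(law(U_t) ‖ μ_{β'})` along every solution

Helper file (seat `ym-line-csu-p1`, g22; `--supports stmt-QuantumFields-27363`).  `μ_{β'} = Z⁻¹ e^{−β'S} Haar^{⊗E}` with `0 ≤ S ≤ 4·#𝒫`
(`wilsonMeasure_eq_tilted_pi`), and the carré du champ of the SZZ coordinate generator does not depend on `β'`; so the Holley–Stroock
bounded-perturbation lemma FOR LOG-SOBOLEV INEQUALITIES (`Literature…holleyStroock_entropy_tilted_le`, BGL Prop. 5.1.6) transfers the
product-Haar inequality `haar_generatorLogSobolev` (constant `1/2`, g22) to `μ_{β'}`: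

* ★★ `generatorLogSobolev_holleyStroock` — generator-form LSI(`ρ₀`) on `C³` cylinders at `β' = 0` ⇒ LSI(`ρ₀ e^{−4|β'|#𝒫}`) at `β'`;
* ★★ `wilson_generatorLogSobolev_explicit` — for every `L, β'` and every `C³` `f` (`F = f∘coords`):
  `(1/2)e^{−4|β'|#𝒫} · Ent_{μ_{β'}}(F²) ≤ −∫ F 𝓛_{β'}f dμ_{β'}` — the FIRST log-Sobolev inequality for the SZZ Wilson measure at a
  fixed cut-off in the tree (the hypothesis `hLSgen` of g21's decay theorems, DISCHARGED);
* ★★ `wilson_entropy_transition_le_exp_explicit` — UNCONDITIONAL exponential decay of the entropy of every bounded measurable density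
  under the SZZ transition kernels: `Ent_μ(κ_t g) ≤ exp(−2e^{−4|β'|#𝒫} t) Ent_μ(g)`;
* ★★ `wilson_klDiv_map_le_exp_explicit` — UNCONDITIONAL `KL(law(U_{τ₀+u}) ‖ μ_{β'}) ≤ exp(−2e^{−4|β'|#𝒫} u) KL(law(U_{τ₀}) ‖ μ_{β'})`
  for every solution from a deterministic start on any probability space, every `τ₀ > 0`.

THEOREMS ONLY, no definition, no sorry.  HONEST FRAMING: RECORD-rung R3 plumbing at FIXED cut-off: the constant `(1/2)e^{−4|β'|#𝒫}`
(`#𝒫 = 3L³`) is WORTHLESS uniformly in the cut-off (at the SZZ coupling `β'_K = (γε_K)⁻¹/2` it is `~ exp(−6L_K³/(γε_K))`), exactly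
like the `L²` gap of g19; the K-UNIFORM log-Sobolev inequality in physical units (ULS) — the input of LINE 4's `stub_entropyDissipation`
— remains OPEN; no crux, rung or summit statement is proved; the Yang–Mills mass gap is NOT proved.
-/

set_option autoImplicit false

noncomputable section

namespace Summit.QuantumFields.YangMills.Theorems.ColdStartUniversality

open MeasureTheory ProbabilityTheory Finset Filter Set Topology Metric Function
open scoped BigOperators NNReal ENNReal
open Literature.Probability.Process Literature.MathematicalPhysics.QuantumFieldTheory InformationTheory
open Literature.MathematicalPhysics.QuantumLattice (fundamentalRep fundamentalLatticeRep continuous_fundamentalRep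
  wilsonMeasure_eq_tilted_pi)

variable {L : ℕ} [NeZero L]

/-! ## §1. ★★ Holley–Stroock for the generator-form log-Sobolev inequality -/

/-- ★★ **Holley–Stroock transfer for the log-Sobolev inequality, generator form.**  If product Haar measure `μ₀ = wilsonMeasure 0` on
`SU(2)^E` satisfies `ρ₀ Ent_{μ₀}(F²) ≤ −∫ F 𝓛₀f dμ₀` for every `C³` cylinder `F = f∘coords` (`ρ₀ ≥ 0`), then for every `β'` the Wilson
measure `μ_{β'}` satisfies `ρ₀ e^{−|β'|·4·#𝒫} Ent_{μ_{β'}}(F²) ≤ −∫ F 𝓛_{β'}f dμ_{β'}` for every `C³` `f`.  Ingredients: localisation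
`F = g∘coords` (`g = χ·f` compactly supported, `𝓛g = 𝓛f` on the group); the energy identity `−2∫ G 𝓛g dμ = ∫ Γ(g,g) dμ` at `β'` and at
`0` with the SAME `Γ`; `μ_{β'} = μ₀.tilted(−β'S)` with `0 ≤ S ≤ 4#𝒫`; the abstract lemma `holleyStroock_entropy_tilted_le`.
[cite: HolleyStroock1987] [cite: BakryGentilLedoux2014, Prop. 5.1.6] -/
theorem generatorLogSobolev_holleyStroock (L : ℕ) [NeZero L] (β' : ℝ) {ρ₀ : ℝ} (hρ₀ : 0 ≤ ρ₀)
    (hLS0 : ∀ (f : (Edge 3 L × Fin 2 × Fin 2 × Bool → ℝ) → ℝ), ContDiff ℝ 3 f →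
        let coords : GaugeConfig 3 L (Matrix.specialUnitaryGroup (Fin 2) ℂ) → (Edge 3 L × Fin 2 × Fin 2 × Bool → ℝ) :=
          fun V q => (fun z : ℂ => if q.2.2.2 then z.im else z.re)
            ((fundamentalRep (Fin 2) (V q.1) : Matrix (Fin 2) (Fin 2) ℂ) q.2.1 q.2.2.1)
        let gen : GaugeConfig 3 L (Matrix.specialUnitaryGroup (Fin 2) ℂ) → ℝ := fun V =>
          (∑ i : Edge 3 L × Fin 2 × Fin 2 × Bool, fderiv ℝ f (coords V) (Pi.single i 1) *
              (fun z : ℂ => if i.2.2.2 then z.im else z.re)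
                ((latticeLangevinDynamics (fundamentalLatticeRep 2) 0).drift
                  (matrixConfig (fundamentalRep (Fin 2)) V) i.1 i.2.1 i.2.2.1) +
          1 / 2 * ∑ i : Edge 3 L × Fin 2 × Fin 2 × Bool, ∑ j : Edge 3 L × Fin 2 × Fin 2 × Bool,
            fderiv ℝ (fun z => fderiv ℝ f z (Pi.single i 1)) (coords V) (Pi.single j 1) *
              ∑ n : Edge 3 L × NoiseIdx 2,
                (if n.1 = i.1 then (fun z : ℂ => if i.2.2.2 then z.im else z.re)
                  ((latticeLangevinDynamics (fundamentalLatticeRep 2) 0).noise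
                    (matrixConfig (fundamentalRep (Fin 2)) V) i.1 n.2 i.2.1 i.2.2.1) else 0) *
                (if n.1 = j.1 then (fun z : ℂ => if j.2.2.2 then z.im else z.re)
                  ((latticeLangevinDynamics (fundamentalLatticeRep 2) 0).noise
                    (matrixConfig (fundamentalRep (Fin 2)) V) j.1 n.2 j.2.1 j.2.2.1) else 0))
        ρ₀ * ((∫ V, f (coords V) ^ 2 * Real.log (f (coords V) ^ 2) ∂(wilsonMeasure (d := 3) (L := L) (fundamentalRep (Fin 2)) 0)) -
            (∫ V, f (coords V) ^ 2 ∂(wilsonMeasure (d := 3) (L := L) (fundamentalRep (Fin 2)) 0)) *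
              Real.log (∫ V, f (coords V) ^ 2 ∂(wilsonMeasure (d := 3) (L := L) (fundamentalRep (Fin 2)) 0))) ≤
          -∫ V, f (coords V) * gen V ∂(wilsonMeasure (d := 3) (L := L) (fundamentalRep (Fin 2)) 0))
    (f : (Edge 3 L × Fin 2 × Fin 2 × Bool → ℝ) → ℝ) (hf : ContDiff ℝ 3 f) :
    let coords : GaugeConfig 3 L (Matrix.specialUnitaryGroup (Fin 2) ℂ) → (Edge 3 L × Fin 2 × Fin 2 × Bool → ℝ) :=
      fun V q => (fun z : ℂ => if q.2.2.2 then z.im else z.re)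
        ((fundamentalRep (Fin 2) (V q.1) : Matrix (Fin 2) (Fin 2) ℂ) q.2.1 q.2.2.1)
    let gen : GaugeConfig 3 L (Matrix.specialUnitaryGroup (Fin 2) ℂ) → ℝ := fun V =>
      (∑ i : Edge 3 L × Fin 2 × Fin 2 × Bool, fderiv ℝ f (coords V) (Pi.single i 1) *
          (fun z : ℂ => if i.2.2.2 then z.im else z.re)
            ((latticeLangevinDynamics (fundamentalLatticeRep 2) β').drift
              (matrixConfig (fundamentalRep (Fin 2)) V) i.1 i.2.1 i.2.2.1) +
      1 / 2 * ∑ i : Edge 3 L × Fin 2 × Fin 2 × Bool, ∑ j : Edge 3 L × Fin 2 × Fin 2 × Bool,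
        fderiv ℝ (fun z => fderiv ℝ f z (Pi.single i 1)) (coords V) (Pi.single j 1) *
          ∑ n : Edge 3 L × NoiseIdx 2,
            (if n.1 = i.1 then (fun z : ℂ => if i.2.2.2 then z.im else z.re)
              ((latticeLangevinDynamics (fundamentalLatticeRep 2) β').noise
                (matrixConfig (fundamentalRep (Fin 2)) V) i.1 n.2 i.2.1 i.2.2.1) else 0) *
            (if n.1 = j.1 then (fun z : ℂ => if j.2.2.2 then z.im else z.re)
              ((latticeLangevinDynamics (fundamentalLatticeRep 2) β').noise
                (matrixConfig (fundamentalRep (Fin 2)) V) j.1 n.2 j.2.1 j.2.2.1) else 0))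
    ρ₀ * Real.exp (-(|β'| * (4 * (Fintype.card (Plaquette 3 L) : ℝ)))) *
        ((∫ V, f (coords V) ^ 2 * Real.log (f (coords V) ^ 2) ∂(wilsonMeasure (d := 3) (L := L) (fundamentalRep (Fin 2)) β')) -
          (∫ V, f (coords V) ^ 2 ∂(wilsonMeasure (d := 3) (L := L) (fundamentalRep (Fin 2)) β')) *
            Real.log (∫ V, f (coords V) ^ 2 ∂(wilsonMeasure (d := 3) (L := L) (fundamentalRep (Fin 2)) β'))) ≤
      -∫ V, f (coords V) * gen V ∂(wilsonMeasure (d := 3) (L := L) (fundamentalRep (Fin 2)) β') := by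
  intro coords gen
  classical
  haveI := secondCountableTopology_su2
  haveI := borelSpace_config L
  set μ : Measure (GaugeConfig 3 L (Matrix.specialUnitaryGroup (Fin 2) ℂ)) :=
    wilsonMeasure (d := 3) (L := L) (fundamentalRep (Fin 2)) β' with hμ
  set μ₀ : Measure (GaugeConfig 3 L (Matrix.specialUnitaryGroup (Fin 2) ℂ)) :=
    wilsonMeasure (d := 3) (L := L) (fundamentalRep (Fin 2)) 0 with hμ₀
  haveI : IsProbabilityMeasure μ :=
    isProbabilityMeasure_wilsonMeasure (d := 3) (L := L) (fundamentalRep (Fin 2)) (continuous_fundamentalRep (Fin 2)) β'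
  haveI : IsProbabilityMeasure μ₀ :=
    isProbabilityMeasure_wilsonMeasure (d := 3) (L := L) (fundamentalRep (Fin 2)) (continuous_fundamentalRep (Fin 2)) 0
  have hco : Continuous coords := continuous_coords (L := L)
  set B : ℝ := 4 * (Fintype.card (Plaquette 3 L) : ℝ) with hB
  /- 1. Localisation: `F = g∘coords`, `g = χ·f` compactly supported, `𝓛g = 𝓛f` on the group. -/
  let χ : ContDiffBump (0 : (Edge 3 L × Fin 2 × Fin 2 × Bool) → ℝ) := ⟨2, 3, by norm_num, by norm_num⟩
  set g : ((Edge 3 L × Fin 2 × Fin 2 × Bool) → ℝ) → ℝ := fun y =>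
    (χ : ((Edge 3 L × Fin 2 × Fin 2 × Bool) → ℝ) → ℝ) y * f y with hgdef
  have hg : ContDiff ℝ 3 g := χ.contDiff.mul hf
  have hgc : HasCompactSupport g := χ.hasCompactSupport.mul_right
  have hball : ∀ V : GaugeConfig 3 L (Matrix.specialUnitaryGroup (Fin 2) ℂ),
      coords V ∈ ball (0 : (Edge 3 L × Fin 2 × Fin 2 × Bool) → ℝ) 2 := by
    intro V
    rw [mem_ball, dist_zero_right]
    exact (norm_coords_le_one V).trans_lt (by norm_num)
  have hEq : ∀ y ∈ ball (0 : (Edge 3 L × Fin 2 × Fin 2 × Bool) → ℝ) 2, g y = f y + 0 := by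
    intro y hy
    have h1 : (χ : ((Edge 3 L × Fin 2 × Fin 2 × Bool) → ℝ) → ℝ) y = 1 :=
      χ.one_of_mem_closedBall (ball_subset_closedBall hy)
    simp only [hgdef, h1, one_mul, add_zero]
  have hgF : ∀ V, g (coords V) = f (coords V) := fun V => by rw [hEq _ (hball V), add_zero]
  have hfd : ∀ V, fderiv ℝ g (coords V) = fderiv ℝ f (coords V) := fun V => fderiv_eq_of_eqOn_ball hEq (hball V)
  have hfd2 : ∀ V (v : (Edge 3 L × Fin 2 × Fin 2 × Bool) → ℝ),
      fderiv ℝ (fun z => fderiv ℝ g z v) (coords V) = fderiv ℝ (fun z => fderiv ℝ f z v) (coords V) := fun V v =>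
    fderiv_fderiv_eq_of_eqOn_ball hEq (hball V) v
  set G : GaugeConfig 3 L (Matrix.specialUnitaryGroup (Fin 2) ℂ) → ℝ := fun V => g (coords V) with hGdef
  have hGc : Continuous G := hg.continuous.comp hco
  /- 2. The carré du champ of `g` (the same function at every coupling) and the two generators. -/
  set A : GaugeConfig 3 L (Matrix.specialUnitaryGroup (Fin 2) ℂ) → (Edge 3 L × Fin 2 × Fin 2 × Bool) →
      (Edge 3 L × Fin 2 × Fin 2 × Bool) → ℝ := fun V i j =>
    ∑ n : Edge 3 L × NoiseIdx 2,
      (if n.1 = i.1 then (fun z : ℂ => if i.2.2.2 then z.im else z.re)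
        ((latticeLangevinDynamics (fundamentalLatticeRep 2) β').noise
          (matrixConfig (fundamentalRep (Fin 2)) V) i.1 n.2 i.2.1 i.2.2.1) else 0) *
      (if n.1 = j.1 then (fun z : ℂ => if j.2.2.2 then z.im else z.re)
        ((latticeLangevinDynamics (fundamentalLatticeRep 2) β').noise
          (matrixConfig (fundamentalRep (Fin 2)) V) j.1 n.2 j.2.1 j.2.2.1) else 0) with hA
  set Γ : GaugeConfig 3 L (Matrix.specialUnitaryGroup (Fin 2) ℂ) → ℝ := fun V =>
    ∑ i : Edge 3 L × Fin 2 × Fin 2 × Bool, ∑ j : Edge 3 L × Fin 2 × Fin 2 × Bool,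
      fderiv ℝ g (coords V) (Pi.single i 1) * fderiv ℝ g (coords V) (Pi.single j 1) * A V i j with hΓ
  have hΓ0 : ∀ V, 0 ≤ Γ V := fun V => by
    simp only [hΓ, hA]
    exact carreDuChamp_nonneg (fun i => fderiv ℝ g (coords V) (Pi.single i 1))
      (fun i (n : Edge 3 L × NoiseIdx 2) => if n.1 = i.1 then (fun z : ℂ => if i.2.2.2 then z.im else z.re)
        ((latticeLangevinDynamics (fundamentalLatticeRep 2) β').noise
          (matrixConfig (fundamentalRep (Fin 2)) V) i.1 n.2 i.2.1 i.2.2.1) else 0)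
  have hΓc : Continuous Γ := by
    have hreim : ∀ (c : Bool) {q : GaugeConfig 3 L (Matrix.specialUnitaryGroup (Fin 2) ℂ) → ℂ}, Continuous q →
        Continuous fun V => (fun z : ℂ => if c then z.im else z.re) (q V) := by
      intro c q hq; cases c
      · exact Complex.continuous_re.comp hq
      · exact Complex.continuous_im.comp hq
    have hd1 : ∀ v, Continuous fun y : Edge 3 L × Fin 2 × Fin 2 × Bool → ℝ => fderiv ℝ g y v := fun v =>
      (hg.continuous_fderiv (by norm_num)).clm_apply continuous_const
    have hnoise : ∀ (i : Edge 3 L × Fin 2 × Fin 2 × Bool) (n : Edge 3 L × NoiseIdx 2), Continuous fun V : GaugeConfig 3 L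
        (Matrix.specialUnitaryGroup (Fin 2) ℂ) => (if n.1 = i.1 then (fun z : ℂ => if i.2.2.2 then z.im else z.re)
          ((latticeLangevinDynamics (fundamentalLatticeRep 2) β').noise (matrixConfig (fundamentalRep (Fin 2)) V)
            i.1 n.2 i.2.1 i.2.2.1) else 0) := by
      intro i n
      by_cases h : n.1 = i.1
      · simp only [if_pos h]
        exact hreim _ ((continuous_apply i.2.2.1).comp ((continuous_apply i.2.1).comp
          (continuous_noise_matrixConfig β' i.1 n.2)))
      · simp only [if_neg h]; exact continuous_const
    simp only [hΓ, hA]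
    refine continuous_finsetSum _ fun i _ => continuous_finsetSum _ fun j _ => ?_
    exact (((hd1 _).comp hco).mul ((hd1 _).comp hco)).mul (continuous_finsetSum _ fun n _ => (hnoise i n).mul (hnoise j n))
  set geng : GaugeConfig 3 L (Matrix.specialUnitaryGroup (Fin 2) ℂ) → ℝ := fun V =>
    (∑ i : Edge 3 L × Fin 2 × Fin 2 × Bool, fderiv ℝ g (coords V) (Pi.single i 1) *
        (fun z : ℂ => if i.2.2.2 then z.im else z.re)
          ((latticeLangevinDynamics (fundamentalLatticeRep 2) β').drift
            (matrixConfig (fundamentalRep (Fin 2)) V) i.1 i.2.1 i.2.2.1) +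
    1 / 2 * ∑ i : Edge 3 L × Fin 2 × Fin 2 × Bool, ∑ j : Edge 3 L × Fin 2 × Fin 2 × Bool,
      fderiv ℝ (fun z => fderiv ℝ g z (Pi.single i 1)) (coords V) (Pi.single j 1) * A V i j) with hgengdef
  set geng0 : GaugeConfig 3 L (Matrix.specialUnitaryGroup (Fin 2) ℂ) → ℝ := fun V =>
    (∑ i : Edge 3 L × Fin 2 × Fin 2 × Bool, fderiv ℝ g (coords V) (Pi.single i 1) *
        (fun z : ℂ => if i.2.2.2 then z.im else z.re)
          ((latticeLangevinDynamics (fundamentalLatticeRep 2) 0).drift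
            (matrixConfig (fundamentalRep (Fin 2)) V) i.1 i.2.1 i.2.2.1) +
    1 / 2 * ∑ i : Edge 3 L × Fin 2 × Fin 2 × Bool, ∑ j : Edge 3 L × Fin 2 × Fin 2 × Bool,
      fderiv ℝ (fun z => fderiv ℝ g z (Pi.single i 1)) (coords V) (Pi.single j 1) * A V i j) with hgeng0def
  have hgen : ∀ V, geng V = gen V := by
    intro V
    simp only [hgengdef, gen, hA, hfd V, hfd2 V]
  -- energy identities at `β'` and at `0` (same `Γ`)
  have hcarre : 2 * ∫ V, G V * geng V ∂μ = -∫ V, Γ V ∂μ :=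
    two_mul_integral_mul_generator_eq_neg_carre L β' hg hgc
  have hcarre0 : 2 * ∫ V, G V * geng0 V ∂μ₀ = -∫ V, Γ V ∂μ₀ :=
    two_mul_integral_mul_generator_eq_neg_carre L 0 hg hgc
  -- read back on `f`
  have hEntf : (∫ V, f (coords V) ^ 2 * Real.log (f (coords V) ^ 2) ∂μ) -
      (∫ V, f (coords V) ^ 2 ∂μ) * Real.log (∫ V, f (coords V) ^ 2 ∂μ) =
      (∫ V, G V ^ 2 * Real.log (G V ^ 2) ∂μ) - (∫ V, G V ^ 2 ∂μ) * Real.log (∫ V, G V ^ 2 ∂μ) := by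
    simp only [hGdef, hgF]
  have hDir : ∫ V, f (coords V) * gen V ∂μ = ∫ V, G V * geng V ∂μ := by
    simp only [hGdef, hgF, hgen]
  rw [hEntf, hDir]
  have hRHS : -∫ V, G V * geng V ∂μ = (∫ V, Γ V ∂μ) / 2 := by linarith [hcarre]
  rw [hRHS]
  have hIΓ : 0 ≤ ∫ V, Γ V ∂μ := integral_nonneg hΓ0
  rcases hρ₀.lt_or_eq with hρ₀' | hρ₀'
  swap
  · rw [← hρ₀']; simp only [zero_mul]; positivity
  /- 3. The log-Sobolev inequality at `0` for `g`, in carré-du-champ form. -/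
  have hLS0g : ρ₀ * ((∫ V, G V ^ 2 * Real.log (G V ^ 2) ∂μ₀) - (∫ V, G V ^ 2 ∂μ₀) * Real.log (∫ V, G V ^ 2 ∂μ₀)) ≤
      -∫ V, G V * geng0 V ∂μ₀ := hLS0 g hg
  have hLS0' : (∫ V, G V ^ 2 * Real.log (G V ^ 2) ∂μ₀) - (∫ V, G V ^ 2 ∂μ₀) * Real.log (∫ V, G V ^ 2 ∂μ₀) ≤
      (1 / (2 * ρ₀)) * ∫ V, Γ V ∂μ₀ := by
    rw [div_mul_eq_mul_div, le_div_iff₀ (by positivity), one_mul]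
    have : -∫ V, G V * geng0 V ∂μ₀ = (∫ V, Γ V ∂μ₀) / 2 := by linarith [hcarre0]
    rw [this] at hLS0g
    linarith
  /- 4. Holley–Stroock: `μ = μ₀.tilted (−β'S)`, `min 0 (−β'B) ≤ −β'S ≤ max 0 (−β'B)`. -/
  have htilt : μ = μ₀.tilted (fun U => -β' * wilsonAction (fundamentalRep (Fin 2)) U) := by
    rw [hμ, hμ₀, wilsonMeasure_zero_eq_pi]
    exact wilsonMeasure_eq_tilted_pi (fundamentalRep (Fin 2)) (continuous_fundamentalRep (Fin 2)) β'
  have hVm : Measurable fun U : GaugeConfig 3 L (Matrix.specialUnitaryGroup (Fin 2) ℂ) =>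
      -β' * wilsonAction (fundamentalRep (Fin 2)) U :=
    (continuous_const.mul (continuous_wilsonAction_su2 (L := L))).measurable
  have hVa : ∀ U : GaugeConfig 3 L (Matrix.specialUnitaryGroup (Fin 2) ℂ),
      min 0 (-β' * B) ≤ -β' * wilsonAction (fundamentalRep (Fin 2)) U := by
    intro U
    have h0 := wilsonAction_su2_nonneg (L := L) U
    have h1 := wilsonAction_su2_le (L := L) U
    rcases le_or_gt 0 β' with hb | hb
    · refine (min_le_right _ _).trans ?_
      nlinarith
    · refine (min_le_left _ _).trans ?_
      nlinarith
  have hVb : ∀ U : GaugeConfig 3 L (Matrix.specialUnitaryGroup (Fin 2) ℂ),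
      -β' * wilsonAction (fundamentalRep (Fin 2)) U ≤ max 0 (-β' * B) := by
    intro U
    have h0 := wilsonAction_su2_nonneg (L := L) U
    have h1 := wilsonAction_su2_le (L := L) U
    rcases le_or_gt 0 β' with hb | hb
    · refine le_trans ?_ (le_max_left _ _)
      nlinarith
    · refine le_trans ?_ (le_max_right _ _)
      nlinarith
  have hba : max 0 (-β' * B) - min 0 (-β' * B) = |β'| * B := by
    have hB0 : 0 ≤ B := by positivity
    rcases le_or_gt 0 β' with hb | hb
    · have h : -β' * B ≤ 0 := by nlinarith
      rw [max_eq_left h, min_eq_right h, abs_of_nonneg hb]; ring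
    · have h : 0 ≤ -β' * B := by nlinarith
      rw [max_eq_right h, min_eq_left h, abs_of_neg hb]; ring
  have hG2c : Continuous fun V => G V ^ 2 := hGc.pow 2
  have hG2i : Integrable (fun V => G V ^ 2) μ₀ := integrable_of_continuous_of_compactSpace hG2c μ₀
  have hG2li : Integrable (fun V => G V ^ 2 * Real.log (G V ^ 2)) μ₀ :=
    integrable_of_continuous_of_compactSpace (Real.continuous_mul_log.comp hG2c) μ₀
  have hΓi : Integrable Γ μ₀ := integrable_of_continuous_of_compactSpace hΓc μ₀
  have hHS := Literature.Probability.MarkovChains.holleyStroock_entropy_tilted_le μ₀ hVm hVa hVb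
    (g := fun V => G V ^ 2) (Γ := Γ) (fun V => sq_nonneg _) hG2i hG2li (ae_of_all _ hΓ0) hΓi
    (C := 1 / (2 * ρ₀)) (by positivity) hLS0'
  rw [← htilt, hba] at hHS
  -- assemble: `ρ₀ e^{−|β'|B} Ent_μ(G²) ≤ (∫ Γ dμ)/2`
  have hK : Real.exp (-(|β'| * B)) * Real.exp (|β'| * B) = 1 := by rw [← Real.exp_add, neg_add_cancel, Real.exp_zero]
  calc ρ₀ * Real.exp (-(|β'| * B)) * ((∫ V, G V ^ 2 * Real.log (G V ^ 2) ∂μ) - (∫ V, G V ^ 2 ∂μ) * Real.log (∫ V, G V ^ 2 ∂μ))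
      ≤ ρ₀ * Real.exp (-(|β'| * B)) * (Real.exp (|β'| * B) * (1 / (2 * ρ₀)) * ∫ V, Γ V ∂μ) :=
        mul_le_mul_of_nonneg_left hHS (by positivity)
    _ = (∫ V, Γ V ∂μ) / 2 := by
        have hρ : ρ₀ / (2 * ρ₀) = 1 / 2 := by field_simp
        calc ρ₀ * Real.exp (-(|β'| * B)) * (Real.exp (|β'| * B) * (1 / (2 * ρ₀)) * ∫ V, Γ V ∂μ)
            = (Real.exp (-(|β'| * B)) * Real.exp (|β'| * B)) * (ρ₀ / (2 * ρ₀)) * ∫ V, Γ V ∂μ := by ring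
          _ = (∫ V, Γ V ∂μ) / 2 := by rw [hK, hρ]; ring

/-! ## §2. ★★ The explicit log-Sobolev inequality for `μ_{β'}` and the explicit decay of the relative entropy -/

/-- ★★ **The explicit log-Sobolev inequality for the Wilson measure of the SU(2) SZZ dynamics at every fixed cut-off.**  For every `L`,
`β'` and every `C³` function `f` of the real link coordinates (`F = f∘coords`, `μ = μ_{β'}`, `𝓛 = 𝓛_{β'}` the SZZ coordinate generator):
`(1/2)·e^{−|β'|·4·#𝒫} · (∫ F² log F² dμ − (∫ F² dμ) log(∫ F² dμ)) ≤ −∫ F·𝓛f dμ`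
(`haar_generatorLogSobolev` + `generatorLogSobolev_holleyStroock`).  The constant degenerates like `e^{−12|β'|L³}` and carries no
cut-off-uniform information. [cite: BakryGentilLedoux2014, Prop. 5.7.1 and Prop. 5.1.6] [cite: ShenZhuZhuCMP2023, Cor. 4.4 (4.11)] -/
theorem wilson_generatorLogSobolev_explicit (L : ℕ) [NeZero L] (β' : ℝ)
    (f : (Edge 3 L × Fin 2 × Fin 2 × Bool → ℝ) → ℝ) (hf : ContDiff ℝ 3 f) :
    let coords : GaugeConfig 3 L (Matrix.specialUnitaryGroup (Fin 2) ℂ) → (Edge 3 L × Fin 2 × Fin 2 × Bool → ℝ) :=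
      fun V q => (fun z : ℂ => if q.2.2.2 then z.im else z.re)
        ((fundamentalRep (Fin 2) (V q.1) : Matrix (Fin 2) (Fin 2) ℂ) q.2.1 q.2.2.1)
    let gen : GaugeConfig 3 L (Matrix.specialUnitaryGroup (Fin 2) ℂ) → ℝ := fun V =>
      (∑ i : Edge 3 L × Fin 2 × Fin 2 × Bool, fderiv ℝ f (coords V) (Pi.single i 1) *
          (fun z : ℂ => if i.2.2.2 then z.im else z.re)
            ((latticeLangevinDynamics (fundamentalLatticeRep 2) β').drift
              (matrixConfig (fundamentalRep (Fin 2)) V) i.1 i.2.1 i.2.2.1) +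
      1 / 2 * ∑ i : Edge 3 L × Fin 2 × Fin 2 × Bool, ∑ j : Edge 3 L × Fin 2 × Fin 2 × Bool,
        fderiv ℝ (fun z => fderiv ℝ f z (Pi.single i 1)) (coords V) (Pi.single j 1) *
          ∑ n : Edge 3 L × NoiseIdx 2,
            (if n.1 = i.1 then (fun z : ℂ => if i.2.2.2 then z.im else z.re)
              ((latticeLangevinDynamics (fundamentalLatticeRep 2) β').noise
                (matrixConfig (fundamentalRep (Fin 2)) V) i.1 n.2 i.2.1 i.2.2.1) else 0) *
            (if n.1 = j.1 then (fun z : ℂ => if j.2.2.2 then z.im else z.re)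
              ((latticeLangevinDynamics (fundamentalLatticeRep 2) β').noise
                (matrixConfig (fundamentalRep (Fin 2)) V) j.1 n.2 j.2.1 j.2.2.1) else 0))
    (1 / 2 : ℝ) * Real.exp (-(|β'| * (4 * (Fintype.card (Plaquette 3 L) : ℝ)))) *
        ((∫ V, f (coords V) ^ 2 * Real.log (f (coords V) ^ 2) ∂(wilsonMeasure (d := 3) (L := L) (fundamentalRep (Fin 2)) β')) -
          (∫ V, f (coords V) ^ 2 ∂(wilsonMeasure (d := 3) (L := L) (fundamentalRep (Fin 2)) β')) *
            Real.log (∫ V, f (coords V) ^ 2 ∂(wilsonMeasure (d := 3) (L := L) (fundamentalRep (Fin 2)) β'))) ≤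
      -∫ V, f (coords V) * gen V ∂(wilsonMeasure (d := 3) (L := L) (fundamentalRep (Fin 2)) β') :=
  generatorLogSobolev_holleyStroock L β' (ρ₀ := 1 / 2) (by norm_num) (fun h hh => haar_generatorLogSobolev L h hh) f hf

/-- ★★ **Unconditional exponential decay of the relative entropy along every solution of the SU(2) SZZ dynamics at a fixed cut-off.**
For every `L`, `β'`, every solution `U` from a deterministic start on ANY probability space, every lattice time `τ₀ > 0` and `u ≥ 0`:
`KL(law(U_{τ₀+u}) ‖ μ_{β'}) ≤ exp(−4ρu) · KL(law(U_{τ₀}) ‖ μ_{β'})`,   `ρ = (1/2)e^{−|β'|·4·#𝒫}`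
(g21's `klDiv_map_le_exp_of_generatorLogSobolev` with its log-Sobolev hypothesis DISCHARGED by `wilson_generatorLogSobolev_explicit`).
HONEST FRAMING: fixed-cut-off rung; the rate is worthless uniformly in the cut-off. [cite: BakryGentilLedoux2014, Thm 5.2.1] -/
theorem wilson_klDiv_map_le_exp_explicit (L : ℕ) [NeZero L] (β' : ℝ)
    {Ω : Type} [MeasurableSpace Ω] {P : Measure Ω} [IsProbabilityMeasure P]
    {W : ℝ≥0 → Ω → (Edge 3 L × NoiseIdx 2 → ℝ)} (hW : IsFlatBrownian W P)
    {U : ℝ≥0 → Ω → GaugeConfig 3 L (Matrix.specialUnitaryGroup (Fin 2) ℂ)}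
    (z : GaugeConfig 3 L (Matrix.specialUnitaryGroup (Fin 2) ℂ)) (hU0 : ∀ ω, U 0 ω = z)
    (hU : (latticeLangevinDynamics (fundamentalLatticeRep 2) β').IsSolution (fundamentalRep (Fin 2)) hW.natFiltration P W U)
    {τ₀ : ℝ≥0} (hτ₀ : 0 < (τ₀ : ℝ)) (u : ℝ≥0) :
    klDiv (P.map (U (τ₀ + u))) (wilsonMeasure (d := 3) (L := L) (fundamentalRep (Fin 2)) β') ≤
      ENNReal.ofReal (Real.exp (-4 * ((1 / 2 : ℝ) * Real.exp (-(|β'| * (4 * (Fintype.card (Plaquette 3 L) : ℝ))))) * u) *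
        (klDiv (P.map (U τ₀)) (wilsonMeasure (d := 3) (L := L) (fundamentalRep (Fin 2)) β')).toReal) :=
  klDiv_map_le_exp_of_generatorLogSobolev L β' (ρ := (1 / 2 : ℝ) * Real.exp (-(|β'| * (4 * (Fintype.card (Plaquette 3 L) : ℝ)))))
    (by positivity) (fun h hh => wilson_generatorLogSobolev_explicit L β' h hh) hW z hU0 hU hτ₀ u

/-- ★★ **Unconditional exponential decay of the entropy of every bounded measurable density under the SZZ transition kernels at a
fixed cut-off**: `Ent_μ(κ_t g) ≤ exp(−4ρt) Ent_μ(g)`, `ρ = (1/2)e^{−|β'|·4·#𝒫}`, `μ = μ_{β'}`, for every Markov kernel family realising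
the transition laws and every measurable `0 ≤ g ≤ M` (g21's `entropy_transition_le_exp_of_generatorLogSobolev_of_measurable`,
hypothesis discharged).  Fixed-cut-off rung; rate worthless uniformly in the cut-off. [cite: BakryGentilLedoux2014, Thm 5.2.1] -/
theorem wilson_entropy_transition_le_exp_explicit (L : ℕ) [NeZero L] (β' : ℝ)
    (κ : ℝ≥0 → Kernel (GaugeConfig 3 L (Matrix.specialUnitaryGroup (Fin 2) ℂ))
      (GaugeConfig 3 L (Matrix.specialUnitaryGroup (Fin 2) ℂ))) [∀ t, IsMarkovKernel (κ t)]
    (hreal : ∀ (t : ℝ≥0) (x : GaugeConfig 3 L (Matrix.specialUnitaryGroup (Fin 2) ℂ))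
        (Ω : Type) [MeasurableSpace Ω] (P : Measure Ω) [IsProbabilityMeasure P]
        (W : ℝ≥0 → Ω → (Edge 3 L × NoiseIdx 2 → ℝ)) (hW : IsFlatBrownian W P)
        (U : ℝ≥0 → Ω → GaugeConfig 3 L (Matrix.specialUnitaryGroup (Fin 2) ℂ)),
        (∀ ω, U 0 ω = x) →
        (latticeLangevinDynamics (fundamentalLatticeRep 2) β').IsSolution (fundamentalRep (Fin 2))
          hW.natFiltration P W U →
        κ t x = P.map (U t))
    {g : GaugeConfig 3 L (Matrix.specialUnitaryGroup (Fin 2) ℂ) → ℝ} (hgm : Measurable g) {M : ℝ} (hg0 : ∀ x, 0 ≤ g x)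
    (hgM : ∀ x, g x ≤ M) (t : ℝ≥0) :
    (∫ x, (∫ y, g y ∂(κ t x)) * Real.log (∫ y, g y ∂(κ t x)) ∂(wilsonMeasure (d := 3) (L := L) (fundamentalRep (Fin 2)) β')) -
        (∫ x, (∫ y, g y ∂(κ t x)) ∂(wilsonMeasure (d := 3) (L := L) (fundamentalRep (Fin 2)) β')) *
          Real.log (∫ x, (∫ y, g y ∂(κ t x)) ∂(wilsonMeasure (d := 3) (L := L) (fundamentalRep (Fin 2)) β')) ≤
      Real.exp (-4 * ((1 / 2 : ℝ) * Real.exp (-(|β'| * (4 * (Fintype.card (Plaquette 3 L) : ℝ))))) * t) *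
        ((∫ x, g x * Real.log (g x) ∂(wilsonMeasure (d := 3) (L := L) (fundamentalRep (Fin 2)) β')) -
          (∫ x, g x ∂(wilsonMeasure (d := 3) (L := L) (fundamentalRep (Fin 2)) β')) *
            Real.log (∫ x, g x ∂(wilsonMeasure (d := 3) (L := L) (fundamentalRep (Fin 2)) β'))) :=
  entropy_transition_le_exp_of_generatorLogSobolev_of_measurable L β' κ hreal
    (ρ := (1 / 2 : ℝ) * Real.exp (-(|β'| * (4 * (Fintype.card (Plaquette 3 L) : ℝ))))) (by positivity)
    (fun h hh => wilson_generatorLogSobolev_explicit L β' h hh) hgm hg0 hgM t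

end Summit.QuantumFields.YangMills.Theorems.ColdStartUniversality

end
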